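import Mathlib
import HarnessLib
import Summits.CriticalPhenomena.Ising3DConformalLimit.Theorems.BernsteinTemperaturePlanarPressureAMMoments
import Summits.CriticalPhenomena.Ising3DConformalLimit.Theorems.BernsteinTemperaturePlanarPressureAMHyper

/-!
# Route BernsteinTemperature, item `PlanarPressureAM` — file D2: Onsager's double integral

Helper file (supports item `stmt-CriticalPhenomena-10768`). For `0 ≤ β` with `sinh 2β < 1`
(i.e. `β < β_c(2) = log(1+√2)/2`), Onsager's integral is evaluated in the high-temperature
modulus `κ² = 4 sinh² 2β / cosh⁴ 2β`:

`∫₀^{2π}∫₀^{2π} log(cosh² 2β - sinh 2β (cos θ₁ + cos θ₂)) dθ₂ dθ₁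
   = 8π² log cosh 2β - 2π² ∑_{n ≥ 1} (cₙ/n) κ²ⁿ`, `cₙ = (centralBinom n)²/16ⁿ`.

Proof: `log(cosh² - sinh (c₁+c₂)) = 2 log cosh + log(1 - t(c₁+c₂))`, `t = sinh 2β / cosh² 2β`,
`2t < 1`; expand `log(1-u) = -∑ u^{m}/m`, integrate termwise twice (dominated convergence with
geometric bounds), and evaluate the torus moments with file D1.

No definitions are introduced.
-/

namespace Summit.CriticalPhenomena.Ising3DConformalLimit.Theorems

open Real Finset intervalIntegral MeasureTheory
open scoped Topology

/-- Inner termwise integral: `∫₀^{2π} (t (a + cos θ))^{n+1}/(n+1) dθ` in closed form. [folklore] -/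
theorem planarPressureAM_inner_term (t a : ℝ) (n : ℕ) :
    ∫ θ in (0 : ℝ)..2 * π, -((t * (a + cos θ)) ^ (n + 1) / ((n : ℝ) + 1))
      = -(t ^ (n + 1) / ((n : ℝ) + 1)) * ∑ i ∈ range (n + 2),
          a ^ i * ((n + 1).choose i : ℝ) * ∫ θ in (0 : ℝ)..2 * π, cos θ ^ (n + 1 - i) := by
  have hexp : ∀ θ : ℝ, -((t * (a + cos θ)) ^ (n + 1) / ((n : ℝ) + 1))
      = -(t ^ (n + 1) / ((n : ℝ) + 1)) * ∑ i ∈ range (n + 2),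
          a ^ i * ((n + 1).choose i : ℝ) * cos θ ^ (n + 1 - i) := by
    intro θ
    calc -((t * (a + cos θ)) ^ (n + 1) / ((n : ℝ) + 1))
        = -(t ^ (n + 1) / ((n : ℝ) + 1)) * (a + cos θ) ^ (n + 1) := by rw [mul_pow]; ring
      _ = -(t ^ (n + 1) / ((n : ℝ) + 1)) * ∑ i ∈ range (n + 1 + 1),
            a ^ i * cos θ ^ (n + 1 - i) * ((n + 1).choose i : ℝ) := by rw [add_pow]
      _ = -(t ^ (n + 1) / ((n : ℝ) + 1)) * ∑ i ∈ range (n + 2),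
            a ^ i * ((n + 1).choose i : ℝ) * cos θ ^ (n + 1 - i) := by
          rw [show n + 1 + 1 = n + 2 by ring]
          congr 1
          exact Finset.sum_congr rfl fun i _ => by ring
  simp_rw [hexp]
  rw [intervalIntegral.integral_const_mul]
  congr 1
  rw [intervalIntegral.integral_finsetSum (fun i _ => by
    apply Continuous.intervalIntegrable; fun_prop)]
  refine Finset.sum_congr rfl fun i _ => ?_
  rw [intervalIntegral.integral_const_mul]

/-- Inner dominated convergence: for `|t| (|a| + 1) < 1`... concretely for `0 ≤ t`, `2 t < 1`,
`|a| ≤ 1`: `∫₀^{2π} log(1 - t(a + cos θ)) dθ = ∑ₙ ∫₀^{2π} -(t(a+cos θ))^{n+1}/(n+1) dθ`. [folklore] -/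
theorem planarPressureAM_inner_hasSum {t a : ℝ} (ht : 0 ≤ t) (h2t : 2 * t < 1) (ha : |a| ≤ 1) :
    HasSum (fun n : ℕ => ∫ θ in (0 : ℝ)..2 * π, -((t * (a + cos θ)) ^ (n + 1) / ((n : ℝ) + 1)))
      (∫ θ in (0 : ℝ)..2 * π, Real.log (1 - t * (a + cos θ))) := by
  have hu : ∀ θ : ℝ, |t * (a + cos θ)| ≤ 2 * t := by
    intro θ
    rw [abs_mul, abs_of_nonneg ht]
    have : |a + cos θ| ≤ 2 := by
      calc |a + cos θ| ≤ |a| + |cos θ| := abs_add_le _ _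
        _ ≤ 1 + 1 := add_le_add ha (abs_cos_le_one θ)
        _ = 2 := by norm_num
    nlinarith [abs_nonneg (a + cos θ)]
  refine intervalIntegral.hasSum_integral_of_dominated_convergence
    (fun n _ => (2 * t) ^ (n + 1)) (fun n => ?_) (fun n => ?_) ?_ ?_ ?_
  · exact (Continuous.aestronglyMeasurable (by fun_prop))
  · refine ae_of_all _ fun θ _ => ?_
    rw [norm_neg, norm_div, norm_pow, Real.norm_eq_abs, Real.norm_eq_abs,
      abs_of_pos (by positivity : (0 : ℝ) < (n : ℝ) + 1)]
    calc |t * (a + cos θ)| ^ (n + 1) / ((n : ℝ) + 1) ≤ |t * (a + cos θ)| ^ (n + 1) / 1 := by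
          apply div_le_div_of_nonneg_left (by positivity) one_pos
          linarith [(Nat.cast_nonneg n : (0 : ℝ) ≤ n)]
      _ = |t * (a + cos θ)| ^ (n + 1) := div_one _
      _ ≤ (2 * t) ^ (n + 1) := pow_le_pow_left₀ (abs_nonneg _) (hu θ) _
  · refine ae_of_all _ fun θ _ => ?_
    have h2t0 : 0 ≤ 2 * t := by positivity
    have := (summable_geometric_of_lt_one h2t0 h2t).mul_left (2 * t)
    refine this.congr fun n => ?_
    ring
  · exact intervalIntegrable_const
  · refine ae_of_all _ fun θ _ => ?_
    have h1 : |t * (a + cos θ)| < 1 := lt_of_le_of_lt (hu θ) h2t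
    have := (Real.hasSum_pow_div_log_of_abs_lt_one h1).neg
    simpa [neg_neg] using this

/-- Onsager's double integral in the high-temperature modulus (see the module docstring).
[folklore] -/
theorem planarPressureAM_onsager_integral {β : ℝ} (hβ : 0 ≤ β) (hs1 : Real.sinh (2 * β) < 1) :
    ∫ θ₁ in (0 : ℝ)..2 * π, ∫ θ₂ in (0 : ℝ)..2 * π,
        Real.log (Real.cosh (2 * β) ^ 2 - Real.sinh (2 * β) * (Real.cos θ₁ + Real.cos θ₂))
      = 8 * π ^ 2 * Real.log (Real.cosh (2 * β))
        - 2 * π ^ 2 * ∑' n : ℕ, ((Nat.centralBinom n : ℝ) ^ 2 / 16 ^ n / n)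
          * (4 * Real.sinh (2 * β) ^ 2 / Real.cosh (2 * β) ^ 4) ^ n := by
  set s : ℝ := Real.sinh (2 * β) with hs_def
  set C : ℝ := Real.cosh (2 * β) with hC_def
  have hC : 0 < C := Real.cosh_pos _
  have hs0 : 0 ≤ s := by rw [hs_def, Real.sinh_nonneg_iff]; linarith
  have hCs : C ^ 2 = s ^ 2 + 1 := by rw [hC_def, hs_def, Real.cosh_sq]
  set t : ℝ := s / C ^ 2 with ht_def
  have ht0 : 0 ≤ t := by positivity
  have h2t : 2 * t < 1 := by
    rw [ht_def, ← mul_div_assoc, div_lt_one (by positivity), hCs]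
    nlinarith
  -- pointwise identity
  have hpt : ∀ θ₁ θ₂ : ℝ, Real.log (C ^ 2 - s * (cos θ₁ + cos θ₂))
      = 2 * Real.log C + Real.log (1 - t * (cos θ₁ + cos θ₂)) := by
    intro θ₁ θ₂
    have hfac : C ^ 2 - s * (cos θ₁ + cos θ₂) = C ^ 2 * (1 - t * (cos θ₁ + cos θ₂)) := by
      rw [ht_def]; field_simp
    have hpos : 0 < 1 - t * (cos θ₁ + cos θ₂) := by
      have : t * (cos θ₁ + cos θ₂) ≤ 2 * t := by
        nlinarith [cos_le_one θ₁, cos_le_one θ₂]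
      linarith
    rw [hfac, Real.log_mul (by positivity) hpos.ne', Real.log_pow]
    push_cast
    ring
  -- the inner integral, split
  have hinner : ∀ θ₁ : ℝ, ∫ θ₂ in (0 : ℝ)..2 * π, Real.log (C ^ 2 - s * (cos θ₁ + cos θ₂))
      = 4 * π * Real.log C + ∫ θ₂ in (0 : ℝ)..2 * π, Real.log (1 - t * (cos θ₁ + cos θ₂)) := by
    intro θ₁
    have hcont : Continuous fun θ₂ : ℝ => Real.log (1 - t * (cos θ₁ + cos θ₂)) := by
      refine Continuous.log (by fun_prop) fun θ₂ => ?_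
      have : t * (cos θ₁ + cos θ₂) ≤ 2 * t := by nlinarith [cos_le_one θ₁, cos_le_one θ₂]
      linarith
    rw [intervalIntegral.integral_congr (fun θ₂ _ => hpt θ₁ θ₂),
      intervalIntegral.integral_add intervalIntegrable_const (hcont.intervalIntegrable _ _),
      intervalIntegral.integral_const]
    simp only [sub_zero, smul_eq_mul]
    ring
  -- joint continuity of the reduced integrand, continuity of the inner integral
  have hjoint : Continuous (fun p : ℝ × ℝ => Real.log (1 - t * (cos p.1 + cos p.2))) := by
    refine Continuous.log (by fun_prop) fun p => ?_
    have : t * (cos p.1 + cos p.2) ≤ 2 * t := by nlinarith [cos_le_one p.1, cos_le_one p.2]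
    linarith
  have hgcont : Continuous fun θ₁ : ℝ => ∫ θ₂ in (0 : ℝ)..2 * π, Real.log (1 - t * (cos θ₁ + cos θ₂)) :=
    intervalIntegral.continuous_parametric_intervalIntegral_of_continuous' hjoint 0 (2 * π)
  -- the outer integral, split
  have houter : ∫ θ₁ in (0 : ℝ)..2 * π, ∫ θ₂ in (0 : ℝ)..2 * π,
        Real.log (C ^ 2 - s * (cos θ₁ + cos θ₂))
      = 8 * π ^ 2 * Real.log C + ∫ θ₁ in (0 : ℝ)..2 * π, ∫ θ₂ in (0 : ℝ)..2 * π,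
          Real.log (1 - t * (cos θ₁ + cos θ₂)) := by
    rw [intervalIntegral.integral_congr (fun θ₁ _ => hinner θ₁),
      intervalIntegral.integral_add intervalIntegrable_const (hgcont.intervalIntegrable _ _),
      intervalIntegral.integral_const]
    simp only [sub_zero, smul_eq_mul]
    ring
  rw [houter]
  -- termwise integration: inner, then outer
  have hin : ∀ θ₁ : ℝ, HasSum (fun n : ℕ => -(t ^ (n + 1) / ((n : ℝ) + 1)) * ∑ i ∈ range (n + 2),
        cos θ₁ ^ i * ((n + 1).choose i : ℝ) * ∫ θ in (0 : ℝ)..2 * π, cos θ ^ (n + 1 - i))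
      (∫ θ₂ in (0 : ℝ)..2 * π, Real.log (1 - t * (cos θ₁ + cos θ₂))) := by
    intro θ₁
    have h := planarPressureAM_inner_hasSum ht0 h2t (abs_cos_le_one θ₁)
    refine h.congr_fun fun n => ?_
    exact (planarPressureAM_inner_term t (cos θ₁) n).symm
  -- outer dominated convergence
  have hout : HasSum (fun n : ℕ => ∫ θ₁ in (0 : ℝ)..2 * π, -(t ^ (n + 1) / ((n : ℝ) + 1))
        * ∑ i ∈ range (n + 2), cos θ₁ ^ i * ((n + 1).choose i : ℝ)
          * ∫ θ in (0 : ℝ)..2 * π, cos θ ^ (n + 1 - i))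
      (∫ θ₁ in (0 : ℝ)..2 * π, ∫ θ₂ in (0 : ℝ)..2 * π, Real.log (1 - t * (cos θ₁ + cos θ₂))) := by
    refine intervalIntegral.hasSum_integral_of_dominated_convergence
      (fun n _ => (2 * t) ^ (n + 1) * |2 * π - 0|) (fun n => ?_) (fun n => ?_) ?_ ?_ ?_
    · exact Continuous.aestronglyMeasurable (by fun_prop)
    · refine ae_of_all _ fun θ₁ _ => ?_
      rw [← planarPressureAM_inner_term t (cos θ₁) n]
      apply intervalIntegral.norm_integral_le_of_norm_le_const
      intro θ _
      rw [norm_neg, norm_div, norm_pow, Real.norm_eq_abs, Real.norm_eq_abs,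
        abs_of_pos (by positivity : (0 : ℝ) < (n : ℝ) + 1)]
      have hu : |t * (cos θ₁ + cos θ)| ≤ 2 * t := by
        rw [abs_mul, abs_of_nonneg ht0]
        have : |cos θ₁ + cos θ| ≤ 2 := by
          calc |cos θ₁ + cos θ| ≤ |cos θ₁| + |cos θ| := abs_add_le _ _
            _ ≤ 1 + 1 := add_le_add (abs_cos_le_one θ₁) (abs_cos_le_one θ)
            _ = 2 := by norm_num
        nlinarith [abs_nonneg (cos θ₁ + cos θ)]
      calc |t * (cos θ₁ + cos θ)| ^ (n + 1) / ((n : ℝ) + 1)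
          ≤ |t * (cos θ₁ + cos θ)| ^ (n + 1) / 1 := by
            apply div_le_div_of_nonneg_left (by positivity) one_pos
            linarith [(Nat.cast_nonneg n : (0 : ℝ) ≤ n)]
        _ = |t * (cos θ₁ + cos θ)| ^ (n + 1) := div_one _
        _ ≤ (2 * t) ^ (n + 1) := pow_le_pow_left₀ (abs_nonneg _) hu _
    · refine ae_of_all _ fun θ₁ _ => ?_
      have h2t0 : 0 ≤ 2 * t := by positivity
      have := (summable_geometric_of_lt_one h2t0 h2t).mul_left (2 * t * |2 * π - 0|)
      refine this.congr fun n => ?_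
      ring
    · exact intervalIntegrable_const
    · exact ae_of_all _ fun θ₁ _ => hin θ₁
  -- evaluate the outer terms with the torus moments
  have hT : ∀ n : ℕ, ∫ θ₁ in (0 : ℝ)..2 * π, -(t ^ (n + 1) / ((n : ℝ) + 1))
        * ∑ i ∈ range (n + 2), cos θ₁ ^ i * ((n + 1).choose i : ℝ)
          * ∫ θ in (0 : ℝ)..2 * π, cos θ ^ (n + 1 - i)
      = -(t ^ (n + 1) / ((n : ℝ) + 1)) * ∑ i ∈ range (n + 1 + 1), ((n + 1).choose i : ℝ)
          * (∫ θ in (0 : ℝ)..2 * π, cos θ ^ i) * (∫ θ in (0 : ℝ)..2 * π, cos θ ^ (n + 1 - i)) := by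
    intro n
    rw [intervalIntegral.integral_const_mul,
      intervalIntegral.integral_finsetSum (fun i _ => by
        apply Continuous.intervalIntegrable; fun_prop)]
    congr 1
    refine Finset.sum_congr rfl fun i _ => ?_
    rw [intervalIntegral.integral_mul_const, intervalIntegral.integral_mul_const]
    ring
  have hout' := hout.congr_fun fun n => (hT n).symm
  -- the modulus and the target series
  set x : ℝ := 4 * s ^ 2 / C ^ 4 with hx_def
  have hxt : x = 4 * t ^ 2 := by rw [hx_def, ht_def]; field_simp
  have hx0 : 0 ≤ x := by positivity
  have hx1 : x < 1 := by rw [hxt]; nlinarith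
  have hφ : Summable fun n : ℕ => ((Nat.centralBinom n : ℝ) ^ 2 / 16 ^ n / n) * x ^ n := by
    refine Summable.of_norm_bounded (summable_geometric_of_lt_one hx0 hx1) fun n => ?_
    rw [Real.norm_eq_abs, abs_mul, abs_pow, abs_of_nonneg hx0]
    refine mul_le_of_le_one_left (by positivity) ?_
    obtain ⟨h0, h1⟩ := planarPressureAM_c_bounds n
    rw [abs_div, abs_of_nonneg h0, Nat.abs_cast]
    rcases n with _ | n
    · simp
    · exact (div_le_self h0 (by exact_mod_cast Nat.succ_le_succ (Nat.zero_le n))).trans h1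
  have hQ := hφ.hasSum
  have hQ1 := (hasSum_nat_add_iff' 1).mpr hQ
  simp only [Finset.sum_range_one, Nat.cast_zero, div_zero, zero_mul, sub_zero] at hQ1
  -- odd-indexed outer terms reproduce the series, even-indexed ones vanish
  have hodd : HasSum (fun k : ℕ => -(t ^ (2 * k + 1 + 1) / (((2 * k + 1 : ℕ) : ℝ) + 1))
        * ∑ i ∈ range (2 * k + 1 + 1 + 1), ((2 * k + 1 + 1).choose i : ℝ)
          * (∫ θ in (0 : ℝ)..2 * π, cos θ ^ i) * (∫ θ in (0 : ℝ)..2 * π, cos θ ^ (2 * k + 1 + 1 - i)))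
      (-(2 * π ^ 2) * ∑' n : ℕ, ((Nat.centralBinom n : ℝ) ^ 2 / 16 ^ n / n) * x ^ n) := by
    have h := hQ1.mul_left (-(2 * π ^ 2))
    refine h.congr_fun fun k => ?_
    have hm := planarPressureAM_moment_even (k + 1)
    rw [show 2 * (k + 1) = 2 * k + 1 + 1 by ring] at hm
    rw [hm, hxt]
    have hk : ((k : ℝ) + 1) ≠ 0 := by positivity
    have h4 : (4 : ℝ) ^ (k + 1) ≠ 0 := pow_ne_zero _ (by norm_num)
    have h16 : (16 : ℝ) ^ (k + 1) ≠ 0 := pow_ne_zero _ (by norm_num)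
    push_cast
    rw [show (16 : ℝ) ^ (k + 1) = 4 ^ (k + 1) * 4 ^ (k + 1) by rw [← mul_pow]; norm_num,
      show (4 * t ^ 2) ^ (k + 1) = 4 ^ (k + 1) * t ^ (2 * k + 1 + 1) by
        rw [mul_pow, ← pow_mul]; ring_nf]
    field_simp
    ring
  have heven : HasSum (fun k : ℕ => -(t ^ (2 * k + 1) / (((2 * k : ℕ) : ℝ) + 1))
        * ∑ i ∈ range (2 * k + 1 + 1), ((2 * k + 1).choose i : ℝ)
          * (∫ θ in (0 : ℝ)..2 * π, cos θ ^ i) * (∫ θ in (0 : ℝ)..2 * π, cos θ ^ (2 * k + 1 - i)))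
      0 := by
    have : (fun k : ℕ => -(t ^ (2 * k + 1) / (((2 * k : ℕ) : ℝ) + 1))
        * ∑ i ∈ range (2 * k + 1 + 1), ((2 * k + 1).choose i : ℝ)
          * (∫ θ in (0 : ℝ)..2 * π, cos θ ^ i) * (∫ θ in (0 : ℝ)..2 * π, cos θ ^ (2 * k + 1 - i)))
        = fun _ => 0 := by
      funext k
      rw [show 2 * k + 1 + 1 = 2 * k + 2 by ring, planarPressureAM_moment_odd k, mul_zero]
    rw [this]
    exact hasSum_zero
  have hboth := HasSum.even_add_odd (f := fun n : ℕ => -(t ^ (n + 1) / ((n : ℝ) + 1))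
      * ∑ i ∈ range (n + 1 + 1), ((n + 1).choose i : ℝ)
        * (∫ θ in (0 : ℝ)..2 * π, cos θ ^ i) * (∫ θ in (0 : ℝ)..2 * π, cos θ ^ (n + 1 - i)))
    heven hodd
  have hval := hout'.unique hboth
  rw [hval]
  ring

end Summit.CriticalPhenomena.Ising3DConformalLimit.Theorems
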